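import Summits.CriticalPhenomena.PercolationContinuityZ3.Theorems.PercNearOneGluingNoHeavyQuantAtMostRBound
import Summits.CriticalPhenomena.PercolationContinuityZ3.Theorems.PercNearOneGluingNoHeavyQuantEnvelopeTwo
import HarnessLib

/-!
# QUANT lane R8, Conjecture DIB\* — "AT LEAST THREE OF `n`" and DIB\* FOR TIED BLOBS WITH `2s ≤ j < 3s` (kernel, unconditional)

builds on p205010 (kernel theorem, internal audit signed; external expert review pending)

Support file (`--supports stmt-CriticalPhenomena-4575`), QUANT lane typer seat prim-quant-stmt (gen 20).  Theorems only.  The general-`r` reduction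
`…QuantAtMostRBound` (`amr_le_of_credit`, `term_ge_of_subsetsCompleting`, `tail_ge_of_subsetsCompleting`, `tail_ge_of_tied_general` — all modulo
the envelope inequality `E(n, r, 1 − x) ≤ 1`) combined with `…QuantEnvelopeTwo` (`envelopeTwo_le_one`: `E(n, 2, y) ≤ 1` for `n ≥ 5`, `y ≤ 1/2`):

* `Quant.IndepBlob.envelope_hyp_two` — the hypothesis of the general theorems at `r = 2`, discharged.
* **`Quant.IndepBlob.amrTwo_le_of_credit`** — `1/2 ≤ x < 1`, independent events with `Σ φ_x(g k) ≥ 4` ⟹ `P(at least three occur) ≥ x`.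
* **`Quant.RootDec.term_ge_of_threeSubsetsCompleting`** — TERM rule: every three blobs of `T` complete at the sure part, rates `≥ 4` ⟹ `x ≤ TERM`.
* **`Quant.IndepBlob.tail_ge_of_threeCompleting`** — DIB\* when every non-empty blob has `2a ≤ j` and every three non-empty blobs complete.
* **`Quant.IndepBlob.tail_ge_of_tied_three`** — DIB\* for all systems of blobs tied at a size `s` with `2s ≤ j < 3s`, any number of blobs.
With `…QuantPairCompleting` (`r = 1`: tied sizes `s ≤ j < 2s`) the tied family is now kernel for `j < 3s`; `r ≥ 3` waits only for `E(n, r, y) ≤ 1`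
(numerically `≤ 0.476`).  [this work]; the gluing rows served [cite: KozmaNitzan2024, Conjecture 3 (p. 15)].
-/

namespace Summit.CriticalPhenomena.PercolationContinuityZ3.Theorems

namespace Quant

namespace IndepBlob

open Finset

section Three

variable {κ : Type} [DecidableEq κ]

/-- probability that at most `r` blobs of `T` are open, closure probabilities `q` (as in `…QuantAtMostR`) -/
local notation3 "AMR[" r ", " T ", " q "]" =>
  ∑ O ∈ ((T : Finset κ).powerset.filter (fun O => O.card ≤ (r : ℕ))),
    (∏ k ∈ O, (1 - (q : κ → ℝ) k)) * ∏ k ∈ (T : Finset κ) \ O, (q : κ → ℝ) k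

/-- The envelope hypothesis of `amr_le_of_credit` at `r = 2`, discharged by `envelopeTwo_le_one`. [this work] -/
theorem envelope_hyp_two (x : ℝ) (hx : 1 / 2 ≤ x) (hx1 : x < 1) :
    ∀ n : ℕ, 2 * 2 + 1 ≤ n → ∑ i ∈ Finset.range (2 + 1),
      (n.choose i : ℝ) * (1 - x) ^ (n - 1 - i) * (1 - (1 - x) / 2) ^ i * (2 - (1 - x) - 2 * ((2 : ℕ) : ℝ) / n) ^ (n - i) ≤ 1 := by
  intro n hn
  have h := envelopeTwo_le_one n (by omega) (1 - x) (by linarith) (by linarith)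
  exact_mod_cast h

/-- **AT LEAST THREE OF `n`** (unconditional): `1/2 ≤ x < 1`; independent events `k ∈ T` with probabilities `g k ∈ [0,1]` whose credit rates
`φ_x(g k)` sum to `≥ 4` ⟹ `P(at most two occur) = AMR[2, T, 1 − g] ≤ 1 − x`, i.e. `P(at least three occur) ≥ x`. [this work] -/
theorem amrTwo_le_of_credit (x : ℝ) (hx : 1 / 2 ≤ x) (hx1 : x < 1) (T : Finset κ) (g : κ → ℝ)
    (hg : ∀ k ∈ T, 0 ≤ g k ∧ g k ≤ 1)
    (hcr : (4 : ℝ) ≤ ∑ k ∈ T, (if x ≤ g k then g k else (g k - x ^ 2) / (1 - x))) :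
    AMR[2, T, fun k => 1 - g k] ≤ 1 - x :=
  amr_le_of_credit 2 (by norm_num) x hx hx1 T g hg (by push_cast; linarith) (envelope_hyp_two x hx hx1)

end Three

end IndepBlob

namespace RootDec

open Finset

variable {κ : Type} [Fintype κ] [DecidableEq κ]

/-- product-Bernoulli weight of the set `W` of open blobs (as in `…QuantRootReduction`) -/
local notation3 "wt[" g ", " W "]" => ∏ k, (if k ∈ (W : Finset κ) then (g : κ → ℝ) k else 1 - (g : κ → ℝ) k)

/-- the TERM tail `P(s + Σ_{k open} a k ≥ j+1)` (as in `…QuantRootReduction`) -/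
local notation3 "TERM[" s ", " a ", " g ", " j "]" =>
  ∑ W : Finset κ, wt[g, W] * (if (j : ℕ) + 1 ≤ (s : ℕ) + ∑ k ∈ W, (a : κ → ℕ) k then (1 : ℝ) else 0)

/-- **THE TRIPLE-COMPLETION CERTIFICATE (TERM rule, unconditional).**  Gates in `[0,1]`, `1/2 ≤ x < 1`; a finset `T` every THREE blobs of which complete at
the sure part `s` (`j + 1 ≤ s + a k + a l + a m`), with credit rates summing to `≥ 4` ⟹ `x ≤ TERM[s, a, g, j]`. [this work] -/
theorem term_ge_of_threeSubsetsCompleting (s : ℕ) (a : κ → ℕ) (g : κ → ℝ) (j : ℕ) (hg : ∀ k, 0 ≤ g k ∧ g k ≤ 1) (T : Finset κ)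
    (hcomp : ∀ U ∈ T.powersetCard 3, j + 1 ≤ s + ∑ k ∈ U, a k) (x : ℝ) (hx : 1 / 2 ≤ x) (hx1 : x < 1)
    (hcr : (4 : ℝ) ≤ ∑ k ∈ T, (if x ≤ g k then g k else (g k - x ^ 2) / (1 - x))) : x ≤ TERM[s, a, g, j] :=
  term_ge_of_subsetsCompleting 2 (by norm_num) s a g j hg T hcomp x hx hx1 (by push_cast; linarith)
    (IndepBlob.envelope_hyp_two x hx hx1)

end RootDec

namespace IndepBlob

open Finset

/-- **DIB\* WHEN EVERY THREE NON-EMPTY BLOBS COMPLETE AND SIZES ARE `≤ j/2`** (unconditional, every floor `1/2 ≤ x < 1`, any number of blobs):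
gates in `[0,1]`, `2·a k ≤ j` for non-empty blobs, every three non-empty blobs reach `j + 1`, credit `> 2j` ⟹ `x ≤ P(N ≥ j+1)`. [this work] -/
theorem tail_ge_of_threeCompleting (x : ℝ) (hx : 1 / 2 ≤ x) (hx1 : x < 1) {ι : Type} [Fintype ι] [DecidableEq ι]
    (a : ι → ℕ) (g : ι → ℝ) (j : ℕ) (hg : ∀ k, 0 ≤ g k ∧ g k ≤ 1) (hsize : ∀ k, 0 < a k → 2 * a k ≤ j)
    (hcomp : ∀ U : Finset ι, U.card = 3 → (∀ k ∈ U, 0 < a k) → j + 1 ≤ ∑ k ∈ U, a k)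
    (hcredit : (2 * j : ℝ) < ∑ k, (a k : ℝ) * (if x ≤ g k then g k else (g k - x ^ 2) / (1 - x))) :
    x ≤ ∑ W : Finset ι, (∏ k, if k ∈ W then g k else 1 - g k) * (if j + 1 ≤ ∑ k ∈ W, a k then (1 : ℝ) else 0) :=
  tail_ge_of_subsetsCompleting 2 (by norm_num) x hx hx1 a g j hg hsize hcomp hcredit (envelope_hyp_two x hx hx1)

/-- **DIB\* FOR TIED BLOBS OF SIZE `s` WITH `2s ≤ j < 3s`** (unconditional, any number of blobs, any heavy/light mix, every floor `1/2 ≤ x < 1`). [this work] -/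
theorem tail_ge_of_tied_three (x : ℝ) (hx : 1 / 2 ≤ x) (hx1 : x < 1) {ι : Type} [Fintype ι] [DecidableEq ι]
    (a : ι → ℕ) (g : ι → ℝ) (j s : ℕ) (hs : 2 * s ≤ j) (hs' : j + 1 ≤ 3 * s) (htied : ∀ k, a k = 0 ∨ a k = s)
    (hg : ∀ k, 0 ≤ g k ∧ g k ≤ 1)
    (hcredit : (2 * j : ℝ) < ∑ k, (a k : ℝ) * (if x ≤ g k then g k else (g k - x ^ 2) / (1 - x))) :
    x ≤ ∑ W : Finset ι, (∏ k, if k ∈ W then g k else 1 - g k) * (if j + 1 ≤ ∑ k ∈ W, a k then (1 : ℝ) else 0) :=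
  tail_ge_of_tied_general 2 (by norm_num) x hx hx1 a g j s hs (by omega) htied hg hcredit (envelope_hyp_two x hx hx1)

end IndepBlob

end Quant

end Summit.CriticalPhenomena.PercolationContinuityZ3.Theorems
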